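/-
Origin: expansion seat `planner-pub-hodgecm-pv15-g2-0`, handover #4 v3 2026-08-18T06:58:23Z (`HOME/pub-hodgecm-pv15-g2/lean/Pv15g2/KernelCarrier.lean`, md5 690de8a5, 317 lines);
landed by the gen-7 packager in gate run 25 as `HodgeCM/Automorphic/KernelCarrier.lean` (import ^import Pv15g2\.→import HodgeCM.Automorphic. ×2).
-/
/-
Origin: HOME/pub-hodgecm-pv15-g2/lean/Pv15g2/KernelCarrier.lean — session planner-pub-hodgecm-pv15-g2-0
(unit pub-hodgecm-pv15-g2, DAG-NODE PROVER #15 gen 2; lineage N23a).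
Intended final place (packager's call): `HodgeCM/Automorphic/KernelCarrier.lean`.
NEW, ADDITIVE; imports `HodgeCM.Automorphic.CocompactCarrier` (my run-24 #3), the LANDED node N21
`HodgeCM.PerL34.KernelOperator` (pv05, run 19: the theta-kernel operator `opTC`), and `…KernelPeriod`, `…KernelUnfolding`
(this hand-over).  KIND: KERNEL — nothing cited, nothing posited.
-/
import Summits.HodgeConjecture.HodgeCM.PerL34.KernelOperator
import Summits.HodgeConjecture.HodgeCM.Automorphic.CocompactCarrier
import Summits.HodgeConjecture.HodgeCM.Automorphic.KernelPeriod
import Summits.HodgeConjecture.HodgeCM.Automorphic.KernelUnfolding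

/-!
# The kernel model of the theta carrier: `𝒯_Φ`, `ϑ_{T,χ}` DEFINED from a theta kernel; (U) a THEOREM

Run 24's regular model fixes `H = L²(G ⧸ Γ)`, `R`, `E^χ_f`; the theta-side data `𝒯_Φ : H → C([G_U])`,
`C([G_U]) ⊆ L²([G_U])` and `ϑ_{T,χ}(Φ) ∈ C([G_U])` stayed abstract, and with them PerL's unfolded pairing (U)
(`RegTorusCarrier.AnalyticU.AX12_unfold`) and AX5b stayed hypotheses.  Here they are DEFINED from ONE prop-free datum,
a continuous theta-kernel family `θ : 𝒮^κ → C(X_U × (G ⧸ Γ), ℂ)` (`θ Φ (g, h) = θ_Φ(g, h)`, PerL l. 405), on a compact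
space `X_U = [G_U]`, together with a bounded linear "inclusion" `ι : C(X_U, ℂ) →L[ℂ] HG` into the Hilbert space modelling
`L²([G_U])` (prop-free data; e.g. `HG := Lp ℂ 2 μ_U`, `ι := ContinuousMap.toLp`, or `HG :=` the discrete part of
`L²([G_U])` and `ι :=` the orthogonal projection after `toLp`):

* `C([G_U]) := C(X_U, ℂ)`;
* `𝒯_Φ := PerL34.KernelOperator.opTC (θ Φ) μQ` — node N21 as LANDED (pv05), i.e.
  `𝒯_Φ(v)(g) = ∫_{[U(W)]} θ_Φ(g, h) v(h) dh` (`PerL34.KernelOperator.evalT_eq_integral`, tex l. 380);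
* `ϑ_{T,χ}(Φ) := KernelOp.period ν (β·χ) (t ↦ π (jT t)⁻¹) (θ Φ)`, i.e. `ϑ_{T,χ}(Φ)(g) = ∫_{[T]} θ_Φ(g, t) χ(t) dt`
  (`KernelTorusCarrier.ϑc_apply`).

THEOREMS (for one torus side `D : KernelTorusCarrier K T`):
* `AX5b_holds` — AX5b (`Φ ↦ ϑ_{T,χ}(Φ)` continuous) from the continuity of `Φ ↦ θ_Φ`;
* `AX12_unfold_holds` — **(U), PerL v5 Prop 3.6 Step 1 (tex ll. 413–417):
  `𝒯_Φ(E^χ_f) = ∫_{U(W)(𝔸)} f(h) ϑ_{T,χ}(ω(h)Φ) dh`** in `L²([G_U])`, in the cocompact Haar model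
  (`RegularRep.IsCocompactHaarModel`), from the Weil-action equivariance of the kernel
  `θ_{ω(h)Φ}(g, q) = θ_Φ(g, h⁻¹ • q)` (l. 414: `θ_Φ(g, y h) = θ_{ω(h)Φ}(g, y)`) and the continuity of
  `h ↦ ϑ_{T,χ}(ω(h)Φ)` — by the landed unfolding `N23a.unfolding_theta` transported to `G ⧸ Γ`
  (`KernelModel.unfolding_theta_quotient`), Fubini-free: the `C(X_U, ℂ)`-valued Bochner integral is evaluated
  pointwise through the evaluation functionals;
* `AnalyticK.toAnalyticU` — the (U)-record of run 24 from the TWO remaining torus-side hypotheses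
  `{AX12_transl_cont, AX8_annihilation}`.
-/

set_option autoImplicit false

noncomputable section

open MeasureTheory Set Filter Function
open scoped InnerProductSpace Pointwise CompactlySupported

namespace HodgeCM

open HodgeCM.PerL34.N23a

/-! ## 1. The kernel-model core -/

/-- **Kernel-model core carrier** (prop-free): the Weil action `ω` on `𝒮^κ`, the theta kernels
`θ_Φ ∈ C([G_U] × [U(W)])`, and the isotypic pieces `τ̂` of `L²([G_U])`. -/
structure KernelCoreCarrier (G : Type) [Group G] [TopologicalSpace G] (Γ : Subgroup G) [MeasurableSpace (G ⧸ Γ)]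
    (μQ : Measure (G ⧸ Γ)) (XU : Type) [TopologicalSpace XU]
    (HG : Type) [NormedAddCommGroup HG] [InnerProductSpace ℂ HG] [CompleteSpace HG]
    (SK SigIdxG : Type) [TopologicalSpace SK] where
  /-- the Weil action `ω(h)` on the index set `𝒮^κ` -/
  omg : G → SK → SK
  /-- the theta kernels `θ_Φ(g, h)` on `[G_U] × [U(W)]` -/
  θ : SK → C(XU × (G ⧸ Γ), ℂ)
  /-- the bounded inclusion `C([G_U]) → L²([G_U])` -/
  inclCG : C(XU, ℂ) →L[ℂ] HG
  /-- AX1b(a): the isotypic components of `L²([G_U])` -/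
  hatτ : SigIdxG → Submodule ℂ HG

namespace KernelCoreCarrier

variable {G : Type} [Group G] [TopologicalSpace G]
variable {Γ : Subgroup G} [MeasurableSpace (G ⧸ Γ)] [BorelSpace (G ⧸ Γ)] [CompactSpace (G ⧸ Γ)]
variable {μQ : Measure (G ⧸ Γ)} [IsFiniteMeasure μQ]
variable {XU : Type} [TopologicalSpace XU] [CompactSpace XU]
variable {HG : Type} [NormedAddCommGroup HG] [InnerProductSpace ℂ HG] [CompleteSpace HG]
variable {SK SigIdxG : Type} [TopologicalSpace SK]
variable (K : KernelCoreCarrier G Γ μQ XU HG SK SigIdxG)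

/-- **The regular-model core of a kernel-model core**: `C([G_U]) := C(X_U, ℂ)`,
`𝒯_Φ :=` node N21's integral operator `opTC` with kernel `θ_Φ`. -/
def toRegCoreCarrier : RegCoreCarrier G Γ μQ HG C(XU, ℂ) SK SigIdxG where
  omg := K.omg
  TΦc := fun Φ => PerL34.KernelOperator.opTC (K.θ Φ) μQ
  inclCG := K.inclCG
  hatτ := K.hatτ

/-- (Ported verbatim from the HodgeCMPerL package; no docstring in the source.) -/
@[simp] theorem toRegCoreCarrier_omg : K.toRegCoreCarrier.omg = K.omg := rfl
/-- (Ported verbatim from the HodgeCMPerL package; no docstring in the source.) -/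
theorem toRegCoreCarrier_TΦc (Φ : SK) : K.toRegCoreCarrier.TΦc Φ = PerL34.KernelOperator.opTC (K.θ Φ) μQ := rfl
/-- (Ported verbatim from the HodgeCMPerL package; no docstring in the source.) -/
@[simp] theorem toRegCoreCarrier_inclCG : K.toRegCoreCarrier.inclCG = K.inclCG := rfl
/-- (Ported verbatim from the HodgeCMPerL package; no docstring in the source.) -/
@[simp] theorem toRegCoreCarrier_hatτ : K.toRegCoreCarrier.hatτ = K.hatτ := rfl

/-- `𝒯_Φ(v)(g) = ∫_{[U(W)]} θ_Φ(g, h) v(h) dh` (PerL l. 380, l. 405) — node N21's `evalT_eq_integral`. -/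
theorem TΦc_apply (Φ : SK) (v : Lp ℂ 2 μQ) (ξ : XU) :
    K.toRegCoreCarrier.TΦc Φ v ξ = ∫ q, K.θ Φ (ξ, q) * v q ∂μQ :=
  PerL34.KernelOperator.evalT_eq_integral (K.θ Φ) μQ v ξ

omit [BorelSpace (G ⧸ Γ)] [CompactSpace (G ⧸ Γ)] [IsFiniteMeasure μQ] [CompactSpace XU] in
/-- The Weil-action equivariance of the kernel (tex l. 414), as an identity of kernels:
`θ_{ω(h)Φ} = θ_Φ(·, h⁻¹ • ·)`. -/
theorem θ_omg_eq [IsTopologicalGroup G]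
    (hθω : ∀ (h : G) (Φ : SK) (ξ : XU) (q : G ⧸ Γ), K.θ (K.omg h Φ) (ξ, q) = K.θ Φ (ξ, h⁻¹ • q))
    (h : G) (Φ : SK) : K.θ (K.omg h Φ) = KernelOp.translFamily (K.θ Φ) h :=
  ContinuousMap.ext fun p => hθω h Φ p.1 p.2

end KernelCoreCarrier

/-! ## 2. One torus side in the kernel model -/

/-- **Kernel-model torus carrier** (prop-free): run 24's `RegTorusCarrier` WITHOUT the field `ϑc` (defined). -/
structure KernelTorusCarrier {G : Type} [Group G] [TopologicalSpace G] {Γ : Subgroup G} [MeasurableSpace (G ⧸ Γ)]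
    {μQ : Measure (G ⧸ Γ)} {XU : Type} [TopologicalSpace XU]
    {HG : Type} [NormedAddCommGroup HG] [InnerProductSpace ℂ HG] [CompleteSpace HG]
    {SK SigIdxG : Type} [TopologicalSpace SK]
    (K : KernelCoreCarrier G Γ μQ XU HG SK SigIdxG)
    (T : Type) [Group T] [TopologicalSpace T] [MeasurableSpace T] where
  /-- the characters `χ` of `[T]` with `χ_∞ = w` — bare index type -/
  X : Type
  /-- `χ` arises from an allowed pair -/
  allowed : X → Prop
  /-- index type of the elements of the compact torus `T(L₀ ⊗ ℝ)` -/
  Tι : Type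
  /-- the compact torus inside `U(W)(𝔸)` -/
  torus : Tι → G
  /-- the weight (character) `w` of `T(L₀ ⊗ ℝ)` -/
  w : Tι → ℂ
  /-- the Haar measure of `T(𝔸)` -/
  ν : Measure T
  /-- the inclusion `T(𝔸) → U(W)(𝔸)` -/
  jT : ContinuousMonoidHom T G
  /-- the `T(L₀)`-partition of unity realising `∫_{[T]} F = ∫_T β F dν` -/
  β : C_c(T, ℝ)
  /-- the character `χ` indexed by `x : X`, as a continuous function on `T(𝔸)` -/
  χv : X → C(T, ℂ)

namespace KernelTorusCarrier

section Basic

variable {G : Type} [Group G] [TopologicalSpace G] {Γ : Subgroup G} [MeasurableSpace (G ⧸ Γ)] {μQ : Measure (G ⧸ Γ)}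
variable {XU : Type} [TopologicalSpace XU]
variable {HG : Type} [NormedAddCommGroup HG] [InnerProductSpace ℂ HG] [CompleteSpace HG]
variable {SK SigIdxG : Type} [TopologicalSpace SK]
variable {K : KernelCoreCarrier G Γ μQ XU HG SK SigIdxG}
variable {T : Type} [Group T] [TopologicalSpace T] [MeasurableSpace T]
variable (D : KernelTorusCarrier K T)

/-- the points `t ↦ π((jT t)⁻¹)` of `G ⧸ Γ` along the torus (the coset-space coordinate of `jT t ∈ Γ\G`) -/
def pt (t : T) : G ⧸ Γ := QuotientGroup.mk (D.jT t)⁻¹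

/-- (Ported verbatim from the HodgeCMPerL package; no docstring in the source.) -/
theorem pt_apply (t : T) : D.pt t = QuotientGroup.mk (D.jT t)⁻¹ := rfl

/-- (Ported verbatim from the HodgeCMPerL package; no docstring in the source.) -/
theorem continuous_pt [IsTopologicalGroup G] : Continuous D.pt :=
  QuotientGroup.continuous_mk.comp D.jT.continuous.inv

/-- (Ported verbatim from the HodgeCMPerL package; no docstring in the source.) -/
theorem hasCompactSupport_wt (x : D.X) : HasCompactSupport (wt D.β (D.χv x)) := by
  have h1 : HasCompactSupport fun t => ((D.β t : ℝ) : ℂ) := D.β.hasCompactSupport.comp_left Complex.ofReal_zero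
  exact h1.mul_right

/-- (Ported verbatim from the HodgeCMPerL package; no docstring in the source.) -/
theorem continuous_wt' (x : D.X) : Continuous (wt D.β (D.χv x)) :=
  continuous_wt D.β.continuous (D.χv x).continuous

variable [CompactSpace XU]

/-- **`ϑ_{T,χ}(Φ) ∈ C([G_U])`, DEFINED**: `∫_T β(t) χ(t) θ_Φ(·, π (jT t)⁻¹) dν(t)`. -/
def ϑc (x : D.X) (Φ : SK) : C(XU, ℂ) := KernelOp.period D.ν (wt D.β (D.χv x)) D.pt (K.θ Φ)

/-- (Ported verbatim from the HodgeCMPerL package; no docstring in the source.) -/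
theorem ϑc_def (x : D.X) (Φ : SK) : D.ϑc x Φ = KernelOp.period D.ν (wt D.β (D.χv x)) D.pt (K.θ Φ) := rfl

/-- `ϑ_{T,χ}(Φ)(g) = ∫_{[T]} θ_Φ(g, t) χ(t) dt` — by definition. -/
theorem ϑc_apply [IsTopologicalGroup G] [OpensMeasurableSpace T] [IsFiniteMeasureOnCompacts D.ν]
    (x : D.X) (Φ : SK) (ξ : XU) :
    D.ϑc x Φ ξ = ∫ t, wt D.β (D.χv x) t * K.θ Φ (ξ, D.pt t) ∂D.ν :=
  KernelOp.period_apply' D.ν (D.continuous_wt' x) (D.hasCompactSupport_wt x) D.continuous_pt (K.θ Φ) ξ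

/-- **AX5b PROVED in the kernel model**: `Φ ↦ ϑ_{T,χ}(Φ)` is continuous as soon as `Φ ↦ θ_Φ` is. -/
theorem AX5b_holds [IsTopologicalGroup G] [CompactSpace (G ⧸ Γ)] [OpensMeasurableSpace T]
    [IsFiniteMeasureOnCompacts D.ν] (hθ : Continuous K.θ) (x : D.X) : Continuous (D.ϑc x) :=
  (KernelOp.continuous_period D.ν (D.continuous_wt' x) (D.hasCompactSupport_wt x) D.continuous_pt).comp hθ

variable [BorelSpace (G ⧸ Γ)] [CompactSpace (G ⧸ Γ)] [IsFiniteMeasure μQ]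

/-- **The regular-model torus carrier of a kernel-model one** (`ϑc` defined). -/
def toRegTorusCarrier : RegTorusCarrier K.toRegCoreCarrier T where
  X := D.X
  allowed := D.allowed
  ϑc := D.ϑc
  Tι := D.Tι
  torus := D.torus
  w := D.w
  ν := D.ν
  jT := D.jT
  β := D.β
  χv := D.χv

/-- (Ported verbatim from the HodgeCMPerL package; no docstring in the source.) -/
@[simp] theorem toRegTorusCarrier_X : D.toRegTorusCarrier.X = D.X := rfl
/-- (Ported verbatim from the HodgeCMPerL package; no docstring in the source.) -/
@[simp] theorem toRegTorusCarrier_ϑc : D.toRegTorusCarrier.ϑc = D.ϑc := rfl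
/-- (Ported verbatim from the HodgeCMPerL package; no docstring in the source.) -/
@[simp] theorem toRegTorusCarrier_ν : D.toRegTorusCarrier.ν = D.ν := rfl
/-- (Ported verbatim from the HodgeCMPerL package; no docstring in the source.) -/
@[simp] theorem toRegTorusCarrier_jT : D.toRegTorusCarrier.jT = D.jT := rfl
/-- (Ported verbatim from the HodgeCMPerL package; no docstring in the source.) -/
@[simp] theorem toRegTorusCarrier_β : D.toRegTorusCarrier.β = D.β := rfl
/-- (Ported verbatim from the HodgeCMPerL package; no docstring in the source.) -/
@[simp] theorem toRegTorusCarrier_χv : D.toRegTorusCarrier.χv = D.χv := rfl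

/-- (Ported verbatim from the HodgeCMPerL package; no docstring in the source.) -/
instance [h : IsFiniteMeasureOnCompacts D.ν] : IsFiniteMeasureOnCompacts D.toRegTorusCarrier.ν := h

end Basic

section Model

variable {G : Type} [Group G] [TopologicalSpace G] [IsTopologicalGroup G] [T2Space G] [LocallyCompactSpace G]
  [MeasurableSpace G] [BorelSpace G]
variable {Γ : Subgroup G} [DiscreteTopology Γ] [IsClosed (Γ : Set G)] [MeasurableSpace (G ⧸ Γ)] [BorelSpace (G ⧸ Γ)]
  [CompactSpace (G ⧸ Γ)]
variable {μQ : Measure (G ⧸ Γ)} [SMulInvariantMeasure G (G ⧸ Γ) μQ] [IsFiniteMeasure μQ]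
variable {XU : Type} [TopologicalSpace XU] [CompactSpace XU]
variable {HG : Type} [NormedAddCommGroup HG] [InnerProductSpace ℂ HG] [CompleteSpace HG]
variable {SK SigIdxG : Type} [TopologicalSpace SK]
variable {K : KernelCoreCarrier G Γ μQ XU HG SK SigIdxG}
variable {T : Type} [Group T] [TopologicalSpace T] [MeasurableSpace T] [OpensMeasurableSpace T]
variable (D : KernelTorusCarrier K T) [IsFiniteMeasureOnCompacts D.ν]

omit [MeasurableSpace G] [BorelSpace G] [SMulInvariantMeasure G (G ⧸ Γ) μQ] in
/-- (Ported verbatim from the HodgeCMPerL package; no docstring in the source.) -/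
theorem toRegTorusCarrier_E (x : D.X) (f : C_c(G, ℂ)) :
    D.toRegTorusCarrier.E x f =
      RegularRep.EisL2 μQ D.ν D.jT D.β (D.χv x) (RegularRep.discreteMeets_of_discrete Γ) f := rfl

/-- **(U) PROVED in the kernel model** (PerL v5 Prop 3.6 Step 1, tex ll. 413–417):
`𝒯_Φ(E^χ_f) = ∫_{U(W)(𝔸)} f(h) ϑ_{T,χ}(ω(h)Φ) dμ(h)` in `L²([G_U])`, for the cocompact Haar model `μ` of
`(Γ, μQ)`, a kernel with the Weil-action equivariance `θ_{ω(h)Φ}(g, q) = θ_Φ(g, h⁻¹ • q)` (l. 414), and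
`h ↦ ϑ_{T,χ}(ω(h)Φ)` continuous (AX12). -/
theorem AX12_unfold_holds [T2Space T] {μ : Measure G} (hM : RegularRep.IsCocompactHaarModel Γ μQ μ)
    (hθω : ∀ (h : G) (Φ : SK) (ξ : XU) (q : G ⧸ Γ), K.θ (K.omg h Φ) (ξ, q) = K.θ Φ (ξ, h⁻¹ • q))
    (Φ : SK) (x : D.X) (f : C_c(G, ℂ)) (hcont : Continuous fun h : G => D.ϑc x (K.omg h Φ)) :
    (K.toRegCoreCarrier.toRepCoreCarrier.toCoreCarrier.TΦ Φ) (D.toRegTorusCarrier.E x f) =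
      ∫ h, (f h : ℂ) • K.toRegCoreCarrier.inclCG (D.toRegTorusCarrier.ϑc x (K.toRegCoreCarrier.omg h Φ)) ∂μ := by
  obtain ⟨𝓕, h𝓕, hμQ⟩ := hM.exists_fundamentalDomain
  haveI := hM.isHaar
  haveI := hM.regular
  haveI := hM.rightInvariant
  haveI := hM.countable
  -- the `C(X_U, ℂ)`-valued integrand is integrable
  have hint : Integrable (fun h : G => (f h : ℂ) • D.ϑc x (K.omg h Φ)) μ :=
    (f.continuous.smul hcont).integrable_of_hasCompactSupport f.hasCompactSupport.smul_right
  -- both sides are images under `ι = K.inclCG` of elements of `C(X_U, ℂ)`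
  change K.inclCG.comp (PerL34.KernelOperator.opTC (K.θ Φ) μQ) (D.toRegTorusCarrier.E x f) =
    ∫ h, (f h : ℂ) • K.inclCG (D.ϑc x (K.omg h Φ)) ∂μ
  have h2 : ∫ h, (f h : ℂ) • K.inclCG (D.ϑc x (K.omg h Φ)) ∂μ
      = K.inclCG (∫ h, (f h : ℂ) • D.ϑc x (K.omg h Φ) ∂μ) := by
    rw [← ContinuousLinearMap.integral_comp_comm _ hint]
    simp only [ContinuousLinearMap.map_smul]
  rw [ContinuousLinearMap.comp_apply, h2]
  congr 1
  -- now an identity in `C(X_U, ℂ)`: evaluate at `ξ`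
  ext ξ
  have h3 : (∫ h, (f h : ℂ) • D.ϑc x (K.omg h Φ) ∂μ) ξ = ∫ h, (f h : ℂ) * D.ϑc x (K.omg h Φ) ξ ∂μ := by
    have h := ((ContinuousMap.evalCLM ℂ ξ : C(XU, ℂ) →L[ℂ] ℂ).integral_comp_comm hint).symm
    simpa only [ContinuousMap.evalCLM_apply, ContinuousMap.smul_apply, smul_eq_mul] using h
  rw [PerL34.KernelOperator.opTC_apply, PerL34.KernelOperator.evalT_eq_integral, h3]
  simp only [ϑc_apply, pt_apply]
  -- replace the `L²` class `E^χ_f` by the function `EisQ`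
  have h4 : ∫ q, K.θ Φ (ξ, q) * (D.toRegTorusCarrier.E x f : G ⧸ Γ → ℂ) q ∂μQ
      = ∫ q, K.θ Φ (ξ, q) * RegularRep.EisQ Γ D.ν D.jT.toMonoidHom D.β (D.χv x) f q ∂μQ := by
    refine integral_congr_ae ?_
    filter_upwards [RegularRep.coeFn_EisL2 μQ D.ν D.jT D.β (D.χv x)
      (RegularRep.discreteMeets_of_discrete Γ) f] with q hq
    rw [toRegTorusCarrier_E, hq]
  rw [h4]
  -- the unfolding on the coset space
  exact KernelModel.unfolding_theta_quotient μ D.ν D.jT.toMonoidHom D.jT.continuous D.β D.β.continuous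
    D.β.hasCompactSupport (D.χv x) (D.χv x).continuous (RegularRep.discreteMeets_of_discrete Γ) 𝓕 h𝓕 hμQ
    f f.continuous f.hasCompactSupport (fun Φ' q => K.θ Φ' (ξ, q)) K.omg Φ
    ((K.θ Φ).continuous.comp (Continuous.prodMk_right ξ)) (fun h q => hθω h Φ ξ q)

omit [T2Space G] [LocallyCompactSpace G] [MeasurableSpace G] [BorelSpace G] [DiscreteTopology Γ]
  [IsClosed (Γ : Set G)] [SMulInvariantMeasure G (G ⧸ Γ) μQ] [BorelSpace (G ⧸ Γ)] [IsFiniteMeasure μQ] in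
/-- **AX12 (`h ↦ ϑ_{T,χ}(ω(h)Φ)` continuous) PROVED in the kernel model**, from the equivariance alone: it is the
composite of the continuous family of translated kernels (`KernelOp.translFamily`, currying — no first countability)
with the bounded period operator. -/
theorem AX12_transl_cont_holds
    (hθω : ∀ (h : G) (Φ : SK) (ξ : XU) (q : G ⧸ Γ), K.θ (K.omg h Φ) (ξ, q) = K.θ Φ (ξ, h⁻¹ • q))
    (x : D.X) (Φ : SK) : Continuous fun h : G => D.ϑc x (K.omg h Φ) := by
  have heq : (fun h : G => D.ϑc x (K.omg h Φ))
      = fun h => KernelOp.period D.ν (wt D.β (D.χv x)) D.pt (KernelOp.translFamily (K.θ Φ) h) :=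
    funext fun h => by rw [ϑc_def, K.θ_omg_eq hθω]
  rw [heq]
  exact (KernelOp.continuous_period D.ν (D.continuous_wt' x) (D.hasCompactSupport_wt x) D.continuous_pt).comp
    (KernelOp.continuous_translFamily (K.θ Φ))

/-- **The ONE remaining torus-side hypothesis in the kernel model — 1 of run 24's 4 (U)-version fields**
(`AX5b_ϑ_cont`, `AX12_transl_cont` and `AX12_unfold` are theorems: `AX5b_holds`, `AX12_transl_cont_holds`,
`AX12_unfold_holds`): PerL Prop 3.6 Step 2. -/
structure AnalyticK : Prop where
  /-- Prop 3.6 Step 2 (ll. 423–434): a vector orthogonal to every `E^χ_f` has vanishing `w`-isotypic part -/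
  AX8_annihilation : ∀ v : Lp ℂ 2 μQ, (∀ x f, ⟪D.toRegTorusCarrier.E x f, v⟫_ℂ = 0) →
    D.toRegTorusCarrier.toRepTorusCarrier.toTorusCarrier.Pw v = 0

variable {D}

/-- **Run 24's (U)-record from the kernel model**: AX5b from the continuity of the kernel family, AX12 from the
equivariance, (U) by unfolding; AX8 carried. -/
theorem AnalyticK.toAnalyticU [T2Space T] {μ : Measure G} (hM : RegularRep.IsCocompactHaarModel Γ μQ μ)
    (hθ : Continuous K.θ)
    (hθω : ∀ (h : G) (Φ : SK) (ξ : XU) (q : G ⧸ Γ), K.θ (K.omg h Φ) (ξ, q) = K.θ Φ (ξ, h⁻¹ • q))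
    (hD : D.AnalyticK) : D.toRegTorusCarrier.AnalyticU μ where
  AX5b_ϑ_cont := fun x => D.AX5b_holds hθ x
  AX12_transl_cont := fun x Φ => D.AX12_transl_cont_holds hθω x Φ
  AX12_unfold := fun Φ x f => D.AX12_unfold_holds hM hθω Φ x f (D.AX12_transl_cont_holds hθω x Φ)
  AX8_annihilation := hD.AX8_annihilation

end Model

end KernelTorusCarrier

end HodgeCM

end
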